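import Summits.BirchSwinnertonDyer.BirchSwinnertonDyer.Theorems.UniversalToricDescentSigmaLocalIndex
import Summits.BirchSwinnertonDyer.BirchSwinnertonDyer.Theorems.UniversalToricDescentSigmaFreeTransport
import HarnessLib

/-!
# Route UniversalToricDescent — the `Σ → ∅` passage ASSEMBLED: `#(Sel_𝔭^{Σ₀∪T}/Sel_𝔭^{Σ₀})[p] =
# ∏_{v ∈ T} (#H¹(H ∩ D_v, E[p^∞])[p])^{p^{c_v}}` (Greenberg–Vatsal (2.10): the algebraic `Σ`-Euler factors)

Lead prover bsd-wall-utd-p1 g8 (`--supports stmt-BirchSwinnertonDyer-20399`; memo ALG-HALF-21845-STATUS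
§3 (d)). After `UniversalToricDescentSigmaLocalSurjective` / `…SigmaLocalIndex` (one place:
`Sel^{Σ∪{v}}/Sel^Σ ≅ H¹(H ∩ D_v, E[p^∞])^{p^{c_v}}`), this file multiplies over a finite set `T` of places
`v ∤ p` finitely decomposed in `K_∞` (exact indices `κ(D_v) = p^{c_v} ℤ_p`):

* §1 (pure group theory) `natCard_quotTorsion_eq_mul_of_divisible` — for subgroups `N ≤ M ≤ L` of an
  abelian group with `M` `n`-divisible, `#(L/N)[n] = #(M/N)[n] · #(L/M)[n]` (`Nat.card`; from g7's
  `natCard_nsmulTorsion_eq_mul_of_divisible` and the third isomorphism theorem).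
* §2 `selmerAc_divisible_of_finite_pTorsion` — `Sel_𝔭^{S}(K_∞, E[p^∞])` is `p`-DIVISIBLE for a finite `S`
  as soon as `Sel^S[p]` is finite, under the (L10) hypotheses: finite `p`-torsion ⟹ `X^S` torsion with
  `μ = 0` (criterion (A)), (L10)^S ⟹ (N1)^S (p581291), hence `X^S[p] = 0` and `Sel^S = p·Sel^S`
  (`UniversalToricDescentSigmaFree`).
* §3 **`natCard_quotient_pTorsion_eq_prod`** — induction on `T`: `#(Sel^{Σ₀∪T}/Sel^{Σ₀})[p] =
  ∏_{v∈T} (#H¹(H ∩ D_v, E[p^∞])[p])^{p^{c_v}}`, given divisibility of the intermediate `Sel^{Σ₀∪T′}`;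
  `natCard_quotient_pTorsion_eq_prod_of_finite` — the same with divisibility discharged by §2 from the
  finiteness of `Sel^{Σ₀∪T}[p]` (e.g. from `X^{Σ₀∪T}` torsion with `μ = 0`).

With `Σ₀ = ∅` and `T = Σ` this identifies the finite group `B^Σ[p] = (Sel^Σ/Sel^∅)[p]` of the `Σ`-free
transport (`pow_lambdaInvariant_mul_natCard_eq`: `p^{λ(X^∅)} · #B^Σ[p] = #Sel^Σ[p]`) with the product of
LOCAL terms — Greenberg–Vatsal's (2.10) `λ(X^Σ) = λ(X^∅) + Σ_v p^{c_v}·corank H¹(K_{∞,w_v}, E[p^∞])` in the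
`#[p]`-currency of the tree. HONEST STATUS: helper theorems, CONDITIONAL on the cited Poitou–Tate fact like
every (L10)-descendant; the identification of `#H¹(H ∩ D_v, E[p^∞])[p]` with an Euler-factor value, the
analytic half and 20395 remain. THEOREMS ONLY; no definition, no named fact, no `sorry`. BSD is not advanced
by this file.
References: [GreenbergVatsal2000] §2 Cor. (2.3), Prop. (2.4), (2.8), (2.10) (pp. 24–28); [Washington1997]
§13.2; [GreenbergLNM1716] §1 p. 60.
-/

set_option autoImplicit false
-- `…BirchSwinnertonDyer.BirchSwinnertonDyer.Theorems…` is the problem's mandated namespace (D-0017).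
set_option linter.dupNamespace false

noncomputable section

open scoped Classical

namespace Summit.BirchSwinnertonDyer.BirchSwinnertonDyer.Theorems.UniversalToricDescentSigmaLocalImage

open Function Field NumberField IsDedekindDomain WeierstrassCurve
open Literature.NumberTheory.GaloisRepresentations Literature.NumberTheory.EllipticCurves
  Literature.NumberTheory.EllipticCurves.GreenbergSelmer Literature.NumberTheory.GaloisCohomology
  Literature.NumberTheory.EllipticCurves.IwasawaAlgebra
  Summit.BirchSwinnertonDyer.Rank1Residual Summit.BirchSwinnertonDyer.Rank1Residual.X11b
  Summit.BirchSwinnertonDyer.Rank1Residual.X11b.Coinv Summit.BirchSwinnertonDyer.Rank1Residual.X11b.AcSelmer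
  Summit.BirchSwinnertonDyer.Rank1Residual.X11b.LocBridge Summit.BirchSwinnertonDyer.Rank1Residual.X11b.H2Support
  Summit.BirchSwinnertonDyer.Rank1Residual.X11b.Levels Summit.BirchSwinnertonDyer.Rank1Residual.Iwasawa
  Summit.BirchSwinnertonDyer.BirchSwinnertonDyer.Theorems.UniversalToricDescentSigmaCoinvariants
  Summit.BirchSwinnertonDyer.BirchSwinnertonDyer.Theorems.UniversalToricDescentSigmaFree
  Summit.BirchSwinnertonDyer.BirchSwinnertonDyer.Theorems.UniversalToricDescentAcDualMuZero
  Summit.BirchSwinnertonDyer.BirchSwinnertonDyer.Theorems.UniversalToricDescentNoFiniteSubmodule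

universe v

/-! ### §1 Pure group theory: `#(L/N)[n] = #(M/N)[n] · #(L/M)[n]` for `N ≤ M ≤ L`, `M` divisible -/

section Group

variable {X : Type v} [AddCommGroup X]

/-- `n`-torsion counts agree along an isomorphism. [folklore] -/
theorem natCard_nsmulTorsion_congr {A B : Type*} [AddGroup A] [AddGroup B] (e : A ≃+ B) (n : ℕ) :
    Nat.card {a : A // n • a = 0} = Nat.card {b : B // n • b = 0} := by
  refine Nat.card_congr (Equiv.subtypeEquiv e.toEquiv fun a ↦ ?_)
  show n • a = 0 ↔ n • e a = 0
  rw [← map_nsmul, ← e.map_zero]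
  exact e.injective.eq_iff.symm

/-- **`#(L/N)[n] = #(M/N)[n] · #(L/M)[n]`** for subgroups `N ≤ M ≤ L` of an abelian group with `M`
`n`-divisible (`Nat.card`): inside `A = L/N` the subgroup `M/N` is `n`-divisible with quotient `L/M`
(third isomorphism theorem), so g7's `natCard_nsmulTorsion_eq_mul_of_divisible` applies. [folklore] -/
theorem natCard_quotTorsion_eq_mul_of_divisible (N M L : AddSubgroup X) (hNM : N ≤ M) (hML : M ≤ L)
    (n : ℕ) (hdiv : ∀ m ∈ M, ∃ m' ∈ M, n • m' = m) :
    Nat.card {b : L ⧸ N.addSubgroupOf L // n • b = 0} =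
      Nat.card {b : M ⧸ N.addSubgroupOf M // n • b = 0} *
        Nat.card {b : L ⧸ M.addSubgroupOf L // n • b = 0} := by
  have hNL : N.addSubgroupOf L ≤ M.addSubgroupOf L := fun x hx ↦ hNM hx
  -- the subgroup `M/N ≤ L/N`
  let Hs : AddSubgroup (L ⧸ N.addSubgroupOf L) :=
    (M.addSubgroupOf L).map (QuotientAddGroup.mk' (N.addSubgroupOf L))
  have hHs : ∀ a ∈ Hs, ∃ b ∈ Hs, n • b = a := by
    rintro _ ⟨m, hm, rfl⟩
    obtain ⟨m', hm', hnm⟩ := hdiv (m : X) hm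
    refine ⟨QuotientAddGroup.mk' _ ⟨m', hML hm'⟩, ⟨⟨m', hML hm'⟩, hm', rfl⟩, ?_⟩
    rw [← map_nsmul]
    congr 1
    exact Subtype.ext (by rw [AddSubgroupClass.coe_nsmul]; exact hnm)
  rw [natCard_nsmulTorsion_eq_mul_of_divisible Hs n hHs]
  congr 1
  · -- `Hs ≃+ M / N`
    let φ : M →+ L ⧸ N.addSubgroupOf L :=
      (QuotientAddGroup.mk' (N.addSubgroupOf L)).comp (AddSubgroup.inclusion hML)
    have hrange : φ.range = Hs := by
      ext a
      constructor
      · rintro ⟨m, rfl⟩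
        exact ⟨AddSubgroup.inclusion hML m, m.2, rfl⟩
      · rintro ⟨m, hm, rfl⟩
        exact ⟨⟨m, hm⟩, rfl⟩
    have hker : φ.ker = N.addSubgroupOf M := by
      ext m
      rw [AddMonoidHom.mem_ker, AddSubgroup.mem_addSubgroupOf]
      show QuotientAddGroup.mk' (N.addSubgroupOf L) (AddSubgroup.inclusion hML m) = 0 ↔ _
      rw [QuotientAddGroup.mk'_apply, QuotientAddGroup.eq_zero_iff, AddSubgroup.mem_addSubgroupOf]
      rfl
    exact (natCard_nsmulTorsion_congr
      (((AddEquiv.addSubgroupCongr hrange.symm).trans (QuotientAddGroup.quotientKerEquivRange φ).symm).trans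
        (QuotientAddGroup.quotientAddEquivOfEq hker)) n)
  · exact natCard_nsmulTorsion_congr
      (QuotientAddGroup.quotientQuotientEquivQuotient (N.addSubgroupOf L) (M.addSubgroupOf L) hNL) n

end Group

/-! ### §2 `Sel_𝔭^S(K_∞, E[p^∞])` is `p`-divisible when `Sel^S[p]` is finite, under (L10) -/

section Selmer

variable {K : Type} [Field K] [NumberField K] (W : WeierstrassCurve K) [W.IsElliptic] (p : ℕ)
  [Fact p.Prime] (κ : ZpExtension K p)

/-- **`Sel_𝔭^S(K_∞, E[p^∞]) = p · Sel_𝔭^S`** for a finite `S` with `Sel^S[p]` finite, under the (L10)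
hypotheses: `X^S` is torsion with `μ = 0` (criterion (A)), (L10)^S gives (N1)^S, so `X^S` has no
`p`-torsion and `Sel^S` is `p`-divisible. [cite: GreenbergVatsal2000, §2 Prop. (2.8)] [cite: Washington1997, §13.2]
[cite: GreenbergLNM1716, Prop. 4.14–4.15 (pp. 124–126)] -/
theorem selmerAc_divisible_of_finite_pTorsion [IsTotallyComplex K]
    (hPT : poitouTate_selmerStructure_duality K)
    (hEP : ∀ v : HeightOneSpectrum (𝓞 K), localEulerPoincareCharacteristic (v.adicCompletion K))
    {𝔭 𝔮 : HeightOneSpectrum (𝓞 K)} (h𝔭 : ((p : ℕ) : 𝓞 K) ∈ 𝔭.asIdeal)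
    (h𝔮 : ((p : ℕ) : 𝓞 K) ∈ 𝔮.asIdeal) (hne : 𝔮 ≠ 𝔭)
    (hΓ𝔭 : ∀ Q : W.geomPrimaryTorsion p,
      (∀ σ : absoluteGaloisGroup (𝔭.adicCompletion K),
        GaloisRep.restrictField (𝔭.adicCompletion K) (primaryGaloisModule W p) σ Q = Q) → Q = 0)
    (hfin : Finite (selmerAcBase W p 𝔮 ∅))
    (h2 : Subsingleton (galoisCohomology (primaryGaloisModule W p) 2))
    (γ : absoluteGaloisGroup K) [hγ : Fact (κ.IsTopGenerator γ)] {S : Set (HeightOneSpectrum (𝓞 K))}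
    (hS : S.Finite) (hfinS : Set.Finite {s : selmerAc W p κ 𝔭 S | p • s = 0}) :
    ∀ s ∈ selmerAc W p κ 𝔭 S, ∃ s' ∈ selmerAc W p κ 𝔭 S, p • s' = s := by
  intro s hs
  have hT := isTorsion_of_finite_pTorsion W p κ 𝔭 S γ hS hfinS
  have hμ := muInvariant_eq_zero_of_finite_pTorsion W p κ 𝔭 S γ hS hfinS
  have hnf := XAc.forall_finite_eq_bot_of_surjective W p κ 𝔭 S γ
    (surjective_conjSelmerAc_sub_one_of_subsingleton W p κ hPT hEP h𝔭 h𝔮 hne hΓ𝔭 hfin h2 hγ.out S)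
  have h0 := XAc.eq_zero_of_nsmul_eq_zero W p κ 𝔭 S γ hS hT hμ hnf
  obtain ⟨t, ht⟩ := selmerAc_divisible_of_forall W p κ 𝔭 S γ h0 ⟨s, hs⟩
  exact ⟨t, t.2, by rw [← AddSubgroupClass.coe_nsmul, ht]⟩

omit [W.IsElliptic] in
/-- `Sel_𝔭^{S′}[p]` is finite when `Sel_𝔭^{S}[p]` is and `S′ ⊆ S` (`Sel^{S′} ≤ Sel^{S}`; the tree's
`finite_selmerAc_pTorsion_empty_of` is `S′ = ∅`). [cite: Castella2018, Def. 2.2 (arXiv:1704.06608 p. 5)] -/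
theorem finite_selmerAc_pTorsion_of_subset {𝔭 : HeightOneSpectrum (𝓞 K)}
    {S S' : Set (HeightOneSpectrum (𝓞 K))} (hS' : S' ⊆ S)
    (hfin : Set.Finite {s : selmerAc W p κ 𝔭 S | p • s = 0}) :
    Set.Finite {s : selmerAc W p κ 𝔭 S' | p • s = 0} := by
  have himg : (fun s : selmerAc W p κ 𝔭 S' ↦ (s : W.subgroupH1 p κ.kerSubgroup)) '' {s | p • s = 0} ⊆
      (fun s : selmerAc W p κ 𝔭 S ↦ (s : W.subgroupH1 p κ.kerSubgroup)) '' {s | p • s = 0} := by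
    rintro _ ⟨s, hs, rfl⟩
    have hs' : p • (s : W.subgroupH1 p κ.kerSubgroup) = 0 := by
      rw [← AddSubgroupClass.coe_nsmul, show p • s = 0 from hs]; rfl
    refine ⟨⟨(s : W.subgroupH1 p κ.kerSubgroup), selmerOver_mono hS' s.2⟩, ?_, rfl⟩
    show p • (⟨(s : W.subgroupH1 p κ.kerSubgroup), selmerOver_mono hS' s.2⟩ : selmerAc W p κ 𝔭 S) = 0
    exact Subtype.ext (by rw [AddSubgroupClass.coe_nsmul]; exact hs')
  exact Set.Finite.of_finite_image ((hfin.image _).subset himg) Subtype.val_injective.injOn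

/-! ### §3 The product over a finite set of finitely decomposed places -/

/-- **`#(Sel_𝔭^{Σ₀∪T}/Sel_𝔭^{Σ₀})[p] = ∏_{v∈T} (#H¹(H ∩ D_v, E[p^∞])[p])^{p^{c_v}}`** for a finite set `T`
of places `v ∤ p`, `v ∉ Σ₀`, finitely decomposed in `K_∞` with exact indices `κ(D_v) = p^{c_v} ℤ_p`, under
the (L10) hypotheses, GIVEN that every intermediate `Sel^{Σ₀∪T′}` (`T′ ⊆ T`) is `p`-divisible: induction on
`T` with `#(L/N)[p] = #(M/N)[p] · #(L/M)[p]` (§1) and the one-place count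
`natCard_quotient_pTorsion_eq_pow`. [cite: GreenbergVatsal2000, §2 Prop. (2.4) and (2.10) (pp. 24–28)] -/
theorem natCard_quotient_pTorsion_eq_prod [IsTotallyComplex K]
    (hPT : poitouTate_selmerStructure_duality K)
    (hEP : ∀ v : HeightOneSpectrum (𝓞 K), localEulerPoincareCharacteristic (v.adicCompletion K))
    {𝔭 𝔮 : HeightOneSpectrum (𝓞 K)} (h𝔭 : ((p : ℕ) : 𝓞 K) ∈ 𝔭.asIdeal)
    (h𝔮 : ((p : ℕ) : 𝓞 K) ∈ 𝔮.asIdeal) (hne : 𝔮 ≠ 𝔭)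
    (hΓ𝔭 : ∀ Q : W.geomPrimaryTorsion p,
      (∀ σ : absoluteGaloisGroup (𝔭.adicCompletion K),
        GaloisRep.restrictField (𝔭.adicCompletion K) (primaryGaloisModule W p) σ Q = Q) → Q = 0)
    (hfin : Finite (selmerAcBase W p 𝔮 ∅))
    (h2 : Subsingleton (galoisCohomology (primaryGaloisModule W p) 2))
    {γ : absoluteGaloisGroup K} (hγ : κ.IsTopGenerator γ) (S₀ : Set (HeightOneSpectrum (𝓞 K)))
    (c : HeightOneSpectrum (𝓞 K) → ℕ) (T : Finset (HeightOneSpectrum (𝓞 K)))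
    (hTp : ∀ v ∈ T, ((p : ℕ) : 𝓞 K) ∉ v.asIdeal) (hTS : ∀ v ∈ T, v ∉ S₀)
    (hc : ∀ v ∈ T, ∀ z : ℤ_[p], ∃ d : decomp (K := K) v,
      (κ (d : absoluteGaloisGroup K)).toAdd = (p : ℤ_[p]) ^ c v * z)
    (hle : ∀ v ∈ T, ∀ d : decomp (K := K) v, (p : ℤ_[p]) ^ c v ∣ (κ (d : absoluteGaloisGroup K)).toAdd)
    (hdiv : ∀ T' : Finset (HeightOneSpectrum (𝓞 K)), T' ⊆ T →
      ∀ s ∈ selmerAc W p κ 𝔭 (S₀ ∪ ↑T'), ∃ s' ∈ selmerAc W p κ 𝔭 (S₀ ∪ ↑T'), p • s' = s) :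
    Nat.card {b : selmerAc W p κ 𝔭 (S₀ ∪ ↑T) ⧸
        (selmerAc W p κ 𝔭 S₀).addSubgroupOf (selmerAc W p κ 𝔭 (S₀ ∪ ↑T)) // p • b = 0} =
      ∏ v ∈ T, Nat.card {f : subgroupH1 (kerD κ v) (W.geomPrimaryTorsion p) // p • f = 0} ^ (p ^ c v) := by
  induction T using Finset.induction_on with
  | empty =>
    rw [Finset.prod_empty, Finset.coe_empty, Set.union_empty]
    haveI : Subsingleton (selmerAc W p κ 𝔭 S₀ ⧸
        (selmerAc W p κ 𝔭 S₀).addSubgroupOf (selmerAc W p κ 𝔭 S₀)) :=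
      ⟨fun a b ↦ by
        induction a using QuotientAddGroup.induction_on with | H a =>
        induction b using QuotientAddGroup.induction_on with | H b =>
        exact QuotientAddGroup.eq.mpr (AddSubgroup.mem_addSubgroupOf.mpr (-a + b).2)⟩
    haveI : Nonempty {b : selmerAc W p κ 𝔭 S₀ ⧸
        (selmerAc W p κ 𝔭 S₀).addSubgroupOf (selmerAc W p κ 𝔭 S₀) // p • b = 0} := ⟨⟨0, smul_zero p⟩⟩
    exact Nat.card_unique
  | @insert v T hvT ih =>
    have hTsub : T ⊆ insert v T := Finset.subset_insert v T
    have ih' := ih (fun w hw ↦ hTp w (hTsub hw)) (fun w hw ↦ hTS w (hTsub hw))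
      (fun w hw ↦ hc w (hTsub hw)) (fun w hw ↦ hle w (hTsub hw))
      (fun T' hT' ↦ hdiv T' (hT'.trans hTsub))
    have hvS : v ∉ S₀ ∪ ↑T := by
      rintro (h | h)
      · exact hTS v (Finset.mem_insert_self v T) h
      · exact hvT (Finset.mem_coe.mp h)
    rw [Finset.prod_insert hvT, Finset.coe_insert, Set.union_insert]
    -- `N = Sel^{S₀} ≤ M = Sel^{S₀ ∪ T} ≤ L = Sel^{(S₀ ∪ T) ∪ {v}}`
    have hNM : selmerAc W p κ 𝔭 S₀ ≤ selmerAc W p κ 𝔭 (S₀ ∪ ↑T) := selmerOver_mono Set.subset_union_left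
    have hML : selmerAc W p κ 𝔭 (S₀ ∪ ↑T) ≤ selmerAc W p κ 𝔭 (insert v (S₀ ∪ ↑T)) :=
      selmerOver_mono (Set.subset_insert _ _)
    have h3 := natCard_quotTorsion_eq_mul_of_divisible (selmerAc W p κ 𝔭 S₀)
      (selmerAc W p κ 𝔭 (S₀ ∪ ↑T)) (selmerAc W p κ 𝔭 (insert v (S₀ ∪ ↑T))) hNM hML p (hdiv T hTsub)
    have hcount := (natCard_quotient_pTorsion_eq_pow W p κ hPT hEP h𝔭 h𝔮 hne hΓ𝔭 hfin h2 hγ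
      (S := S₀ ∪ ↑T) (hTp v (Finset.mem_insert_self v T)) hvS (hc v (Finset.mem_insert_self v T))
      (hle v (Finset.mem_insert_self v T))).2
    rw [h3, ih', hcount, mul_comm]

/-- **`#(Sel_𝔭^{Σ₀∪T}/Sel_𝔭^{Σ₀})[p] = ∏_{v∈T} (#H¹(H ∩ D_v, E[p^∞])[p])^{p^{c_v}}` with the divisibility
DISCHARGED**: same data, `Σ₀` finite, and `Sel^{Σ₀∪T}[p]` finite (e.g. `X^{Σ₀∪T}` torsion with `μ = 0`,
`finite_pTorsion_of_muInvariant_eq_zero`) — every intermediate `Sel^{Σ₀∪T′}` then has finite `p`-torsion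
and is `p`-divisible by §2. With `Σ₀ = ∅`, `T = Σ` this is Greenberg–Vatsal's (2.10) for the finite group
`B^Σ[p]` of the `Σ`-free transport. [cite: GreenbergVatsal2000, §2 Prop. (2.4), (2.8) and (2.10) (pp. 24–28)]
[cite: Washington1997, §13.2] -/
theorem natCard_quotient_pTorsion_eq_prod_of_finite [IsTotallyComplex K]
    (hPT : poitouTate_selmerStructure_duality K)
    (hEP : ∀ v : HeightOneSpectrum (𝓞 K), localEulerPoincareCharacteristic (v.adicCompletion K))
    {𝔭 𝔮 : HeightOneSpectrum (𝓞 K)} (h𝔭 : ((p : ℕ) : 𝓞 K) ∈ 𝔭.asIdeal)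
    (h𝔮 : ((p : ℕ) : 𝓞 K) ∈ 𝔮.asIdeal) (hne : 𝔮 ≠ 𝔭)
    (hΓ𝔭 : ∀ Q : W.geomPrimaryTorsion p,
      (∀ σ : absoluteGaloisGroup (𝔭.adicCompletion K),
        GaloisRep.restrictField (𝔭.adicCompletion K) (primaryGaloisModule W p) σ Q = Q) → Q = 0)
    (hfin : Finite (selmerAcBase W p 𝔮 ∅))
    (h2 : Subsingleton (galoisCohomology (primaryGaloisModule W p) 2))
    (γ : absoluteGaloisGroup K) [hγ : Fact (κ.IsTopGenerator γ)] {S₀ : Set (HeightOneSpectrum (𝓞 K))}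
    (hS₀ : S₀.Finite) (c : HeightOneSpectrum (𝓞 K) → ℕ) (T : Finset (HeightOneSpectrum (𝓞 K)))
    (hTp : ∀ v ∈ T, ((p : ℕ) : 𝓞 K) ∉ v.asIdeal) (hTS : ∀ v ∈ T, v ∉ S₀)
    (hc : ∀ v ∈ T, ∀ z : ℤ_[p], ∃ d : decomp (K := K) v,
      (κ (d : absoluteGaloisGroup K)).toAdd = (p : ℤ_[p]) ^ c v * z)
    (hle : ∀ v ∈ T, ∀ d : decomp (K := K) v, (p : ℤ_[p]) ^ c v ∣ (κ (d : absoluteGaloisGroup K)).toAdd)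
    (hfinT : Set.Finite {s : selmerAc W p κ 𝔭 (S₀ ∪ ↑T) | p • s = 0}) :
    Nat.card {b : selmerAc W p κ 𝔭 (S₀ ∪ ↑T) ⧸
        (selmerAc W p κ 𝔭 S₀).addSubgroupOf (selmerAc W p κ 𝔭 (S₀ ∪ ↑T)) // p • b = 0} =
      ∏ v ∈ T, Nat.card {f : subgroupH1 (kerD κ v) (W.geomPrimaryTorsion p) // p • f = 0} ^ (p ^ c v) :=
  natCard_quotient_pTorsion_eq_prod W p κ hPT hEP h𝔭 h𝔮 hne hΓ𝔭 hfin h2 hγ.out S₀ c T hTp hTS hc hle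
    fun T' hT' ↦ selmerAc_divisible_of_finite_pTorsion W p κ hPT hEP h𝔭 h𝔮 hne hΓ𝔭 hfin h2 γ
      (hS₀.union T'.finite_toSet)
      (finite_selmerAc_pTorsion_of_subset W p κ
        (Set.union_subset_union_right S₀ (Finset.coe_subset.mpr hT')) hfinT)

end Selmer

end Summit.BirchSwinnertonDyer.BirchSwinnertonDyer.Theorems.UniversalToricDescentSigmaLocalImage

end
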